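import Summits.CriticalPhenomena.PercolationContinuityZ3.Theorems.Transplant.PlanarCells2FaceRun
import Summits.CriticalPhenomena.PercolationContinuityZ3.Theorems.Transplant.KNCells2ChainFaceRunRO
import HarnessLib

/-!
# D″ node, (F) part 11c, PLANAR over the two-unit cells (F-DP4-2 repair, p3 ruling 2026-08-21T06:41:05Z; hp-8 column): part 11b's fit
# theorems for the DECOUPLED schedule of record `ChainPlanar.FaceRun.scheduleRO` (`Band.scheduleRO` under the decoupled `Band.BandOKR` of record: the
# transverse half-widths `ρ₁ ρ₂` of the regions are no longer tied to the strides, so `FaceRunFit2.htr` carries no axis-ratio coupling) —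
# same statements and proofs as `faceRun_region_subset_farAS` / `faceRun_core_last_subset_M` with the primed planar lemmas

builds on p205010 (kernel theorem, internal audit signed; external expert review pending) — nothing in this file uses p205010.
Lane `prim-bschramm`, seat `prim-hp-8` (gen 30; L6′ (F) owner); helper file (`--supports stmt-CriticalPhenomena-4575`).  Pure `Site 2`.
* **`faceRunRO_region_subset_farAS`**, **`faceRunRO_core_last_subset_M`** (the first-rectangle footprint lemma `faceRun_firstBox_subset_farAS`
  and `faceRow_range_of_mem` of part 11b are schedule-free and reused as they are).
[cite: KozmaNitzan2024, §4 Lemma 11 (pp. 22–23), p. 26 (M_v), p. 30 (Step III)]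
-/

noncomputable section

namespace Summit.CriticalPhenomena.PercolationContinuityZ3.Theorems

namespace Transplant

open Literature.Probability.Percolation Literature.Probability.LatticeModels
open Literature.Probability.Percolation.KozmaNitzan
open Literature.Probability.Percolation.KozmaNitzan.Cells (oth oth_ne eq_oth_of_ne sgOf sgOf_sign)
open ChainPlanar
open PCells (mem_psBox_iff)

namespace PCells2

variable {P : PCells2} {x : Site 2} {du : MDir} {j : ℕ} {pc : Site 2} {ℓ1 q'₁ s₁ ρ₁ : ℤ} {R' ℓ₀₁ N₁ WM₁ : ℕ} {Wb₁ : ℕ → ℕ}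
  {s₂ ρ₂ : ℤ} {ℓ₀₂ N₂ WM₂ : ℕ} {Wb₂ : ℕ → ℕ} {a₁ : Fin 2 → ℕ}
  (h : FaceRun.TwoBandOKR q'₁ s₁ ρ₁ R' ℓ₀₁ N₁ WM₁ Wb₁ s₂ ρ₂ ℓ₀₂ N₂ WM₂ Wb₂) {ℓ₁₁ ℓ₁₂ : ℕ} (hℓ₁ : 2 * 0 + s₁ + R' ≤ ℓ₁₁)
  (hℓ₂ : 2 * 0 + s₂ + R' ≤ ℓ₁₂)
  (hfit : FaceRunFit2 P du j (P.lev du x pc) (pc (oth du.1) - P.cen x (oth du.1)) ℓ1 q'₁ s₁ ρ₁ R' N₁ WM₁ s₂ ρ₂ N₂ WM₂ a₁)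
include hfit

/-- **Every region of the (F) schedule of record (decoupled variant `FaceRun.scheduleRO`) lies in the shrunk far rows `farAS x du j`.** [cite: KozmaNitzan2024, §4 Lemma 11 (p. 22: Ω)] -/
theorem faceRunRO_region_subset_farAS {k : ℕ} (hk : k ≤ N₁ + 1 + N₂) :
    (FaceRun.scheduleRO du pc ℓ1 h hℓ₁ hℓ₂).region k ⊆ P.farAS x du j := by
  intro y hy
  have h1 := FaceRun.lev_ge_of_mem_regionRO h hℓ₁ hℓ₂ hk hy
  have h2 := FaceRun.lev_le_of_mem_regionRO h hℓ₁ hℓ₂ hk hy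
  have h3 := abs_le.1 (FaceRun.trans_le_of_mem_regionRO h hℓ₁ hℓ₂ hk hy)
  have hbot := hfit.hbot; have htr := hfit.htr; have hM2 := hfit.hM2
  have hcb := le_abs_self (pc (oth du.1) - P.cen x (oth du.1))
  have hcb' := neg_abs_le (pc (oth du.1) - P.cen x (oth du.1))
  have hr1 : (1 : ℤ) ≤ P.r du.1 := by exact_mod_cast P.one_le_r du.1
  rw [P.lev_def] at hbot hM2
  have e : sgOf du * (y du.1 - P.cen x du.1) = sgOf du * (y du.1 - pc du.1) + sgOf du * (pc du.1 - P.cen x du.1) := by ring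
  rw [PCells2.farAS, mem_psBox_iff, e]
  refine ⟨⟨by linarith, by linarith⟩, by linarith, by linarith⟩

/-- **The last core of the (F) schedule of record (decoupled variant) lies in the target cube `M(x + du)`.** [cite: KozmaNitzan2024, §4 p. 26 (M_v), Lemma 11 (p. 23)] -/
theorem faceRunRO_core_last_subset_M : (FaceRun.scheduleRO du pc ℓ1 h hℓ₁ hℓ₂).core (N₁ + 1 + N₂ + 1) ⊆ P.M (x + stepVec du) := by
  intro y hy
  obtain ⟨h1, h2⟩ := FaceRun.lev_core_lastRO h hℓ₁ hℓ₂ hy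
  have h2' := abs_le.1 h2
  have hM1 := hfit.hM1; have hM2 := hfit.hM2; have htrM := hfit.htrM
  have hcb := le_abs_self (pc (oth du.1) - P.cen x (oth du.1))
  have hcb' := neg_abs_le (pc (oth du.1) - P.cen x (oth du.1))
  rw [P.lev_def] at hM1 hM2
  rw [PCells2.M, P.mem_abox_iff]
  intro i
  push_cast
  by_cases hi : i = du.1
  · subst hi
    rw [P.cen_add_stepVec_fst]
    rcases sgOf_sign du with hs | hs
    · rw [hs] at h1 hM1 hM2; rw [hs]; constructor <;> linarith
    · rw [hs] at h1 hM1 hM2; rw [hs]; constructor <;> linarith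
  · rw [eq_oth_of_ne hi, P.cen_add_stepVec_oth]
    constructor <;> linarith

end PCells2

end Transplant

end Summit.CriticalPhenomena.PercolationContinuityZ3.Theorems

end
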